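import Summits.QuantumFields.BalabanUV.T4Continuum.Spine.NE2.TorusBlockAveragePlaquette
import Literature.MathematicalPhysics.QuantumFieldTheory.Balaban1983to89.B7Prop2Explicit

/-!
# T⁴ programme, spine node NE2 (U1a) — F6 (ζ) on the route's carriers, file 3: THE TORUS AVERAGE OF A UNITARY CONFIGURATION IS UNITARY (cell `pub-balaban-gaps`, seat ne2 gen 7)

`TorusAveragedTowerPlaquette.tplaq_tower_le` propagates the plaquette letter down a COHERENT tower `V_i = V̄[V_{i+1}]` of contractive-unit-valued configurations; the ENDs of this node
read towers of UNITARY bond variables.  For the coherence hypothesis to be satisfiable by unitary data beyond the flat tower, the average (42) must preserve unitarity — tacit in print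
(p. 23 «Let U be a gauge field configuration with values in U(N)»; it is what makes (43) iterable) and PROVED in the tree on `ℤ^d` (`B7Prop2Explicit.bavg_mem_unitaryUnits`: the exponent
`X_c` is a real combination of logarithms of unitaries within `1/4` of `1`, hence skew-adjoint, so `e^{X_c}` is unitary; the `1/4`-closeness from `B7Prop2Explicit.norm_Wcx_sub_one_le` under
Prop. 1's smallness).  THIS FILE transfers it to the torus through the periodic lift of file 1:
 * **`bavgTor_mem_unitaryUnits`**: `V` unitary-valued on `Tor (fine (L·N) M)` (a C⋆-algebra `𝔸`, print's `M_N(ℂ)`), `‖V(∂p) − 1‖ ≤ α₀` on all torus plaquettes, `512(d+1)(d+4)L²α₀ ≤ 1`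
   ⟹ every `V̄_c = bavgTor L V y κ` is unitary;
 * **`bavgTor_step`**: the one-step package for building a coherent unitary tower downwards — the average is unitary-valued AND its plaquette letter is `≤ L²α₀ + C₀′(L²α₀)²` (file 1).
HONEST FRAMING (T4-DAG p. 1).  Transfer of tree-PROVED statements about [B7]'s (42) to MODEL carriers; `V` is DATA; NOT NE2; **NE2 (U1a) NOT PROVED**; spine PROVED 0/9 unchanged; NOT continuum YM /
infinite volume / mass gap / Clay.  No `sorry`.
-/

noncomputable section

open scoped BigOperators

namespace Summit.QuantumFields.BalabanUV.T4Continuum.NE2.TorusBlockAverageUnitary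

open Literature.MathematicalPhysics.QuantumFieldTheory.Balaban1983to89
open Literature.MathematicalPhysics.QuantumFieldTheory.Balaban1983to89.B7Prop1Explicit (Site hol plaqWord Wcx bavg U1 boxVec)
open Literature.MathematicalPhysics.QuantumFieldTheory.Balaban1983to89.B7Prop2Explicit (unitaryUnits unitaryUnits_le_U1 bavg_mem_unitaryUnits norm_Wcx_sub_one_le)
open Literature.MathematicalPhysics.QuantumFieldTheory.Balaban1983to89.B5Prop11Plancherel (Tor fine unitVec)
open Summit.QuantumFields.BalabanUV.T4Continuum.NE2.TorusBlockAveragePlaquette (liftCfg liftCfg_apply bavgTor tplaq hol_lift_plaqWord tplaq_bavgTor_sub_one_le zrep)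

variable {d : ℕ} {𝔸 : Type*} [CStarAlgebra 𝔸] [Nontrivial 𝔸]
variable (N L : ℕ) [NeZero N] [NeZero L] (M : Fin d → ℕ) [hM : ∀ μ, NeZero (M μ)]

omit [Nontrivial 𝔸] in
/-- the lift of a unitary-valued torus configuration is unitary-valued. [folklore] -/
theorem liftCfg_mem {P : Fin d → ℕ} {V : Tor P → Fin d → 𝔸ˣ} (hV : ∀ y κ, V y κ ∈ unitaryUnits 𝔸) (x : Site d) (κ : Fin d) : liftCfg V x κ ∈ unitaryUnits 𝔸 := hV _ κ

omit [NeZero N] [NeZero L] hM in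
/-- **THE TORUS AVERAGE OF A UNITARY CONFIGURATION IS UNITARY** under Prop. 1's smallness: every loop variable `V(Γ_{c,x})V(c)⁻¹` of the lift is within `2θ ≤ 1/32` of `1`
(`B7Prop2Explicit.norm_Wcx_sub_one_le`, `θ = 8(d+1)(d+4)L²α₀`), so `B7Prop2Explicit.bavg_mem_unitaryUnits` applies at the representative. [cite: Balaban1985Averaging, (42) p.23, (22)–(23) p.21] [folklore] -/
theorem bavgTor_mem_unitaryUnits (hL : 1 ≤ L) (V : Tor (fine (L * N) M) → Fin d → 𝔸ˣ) (hV : ∀ y κ, V y κ ∈ unitaryUnits 𝔸) {α₀ : ℝ} (hα₀ : 0 ≤ α₀)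
    (hsmall : 512 * (d + 1) * (d + 4) * (L : ℝ) ^ 2 * α₀ ≤ 1)
    (h44 : ∀ (y : Tor (fine (L * N) M)) (κ κ' : Fin d), κ ≠ κ' → ‖((tplaq V y κ κ' : 𝔸ˣ) : 𝔸) - 1‖ ≤ α₀) (y : Tor (fine N M)) (κ : Fin d) :
    bavgTor N L M V y κ ∈ unitaryUnits 𝔸 := by
  unfold bavgTor
  have hU1 : ∀ x κ, liftCfg V x κ ∈ U1 𝔸 := fun x κ => unitaryUnits_le_U1 (hV _ κ)
  have h44' : ∀ (x : Site d) (κ κ' : Fin d), κ ≠ κ' → ‖((hol (liftCfg V) x (plaqWord κ κ') : 𝔸ˣ) : 𝔸) - 1‖ ≤ α₀ := fun x κ κ' hκ => by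
    rw [hol_lift_plaqWord]; exact h44 _ κ κ' hκ
  refine bavg_mem_unitaryUnits (fun x κ => liftCfg_mem hV x κ) L (zrep N L M y) κ fun r => ?_
  refine (norm_Wcx_sub_one_le L hL (liftCfg V) hU1 hα₀ hsmall h44' (zrep N L M y) κ r).trans ?_
  have hd : (0 : ℝ) ≤ d := Nat.cast_nonneg d
  nlinarith

/-- **THE ONE-STEP PACKAGE**: under the plaquette letter `α₀` and Prop. 1's smallness, the torus average of a unitary-valued configuration is unitary-valued AND satisfies the propagated
plaquette letter `L²α₀ + 226·(8(d+1)(d+4)L²α₀)²` — everything a downward construction of a coherent unitary tower needs at each step. [cite: Balaban1985Averaging, Prop. 1 (51) p.26, (42) p.23] [folklore] -/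
theorem bavgTor_step (hL : 1 ≤ L) (V : Tor (fine (L * N) M) → Fin d → 𝔸ˣ) (hV : ∀ y κ, V y κ ∈ unitaryUnits 𝔸) {α₀ : ℝ} (hα₀ : 0 ≤ α₀)
    (hsmall : 512 * (d + 1) * (d + 4) * (L : ℝ) ^ 2 * α₀ ≤ 1)
    (h44 : ∀ (y : Tor (fine (L * N) M)) (κ κ' : Fin d), κ ≠ κ' → ‖((tplaq V y κ κ' : 𝔸ˣ) : 𝔸) - 1‖ ≤ α₀) :
    (∀ y κ, bavgTor N L M V y κ ∈ unitaryUnits 𝔸) ∧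
      ∀ (y : Tor (fine N M)) (μ ν : Fin d), μ ≠ ν → ‖((tplaq (bavgTor N L M V) y μ ν : 𝔸ˣ) : 𝔸) - 1‖ ≤ (L : ℝ) ^ 2 * α₀ + 226 * (8 * (d + 1) * (d + 4) * (L : ℝ) ^ 2 * α₀) ^ 2 :=
  ⟨fun y κ => bavgTor_mem_unitaryUnits N L M hL V hV hα₀ hsmall h44 y κ,
    fun y _ _ hμν => tplaq_bavgTor_sub_one_le N L M hL V (fun y κ => unitaryUnits_le_U1 (hV y κ)) hα₀ hsmall h44 y hμν⟩

end Summit.QuantumFields.BalabanUV.T4Continuum.NE2.TorusBlockAverageUnitary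

end
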